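import Literature.NumberTheory.Automorphic.AnisotropicUnitaryGroupCompact
import Literature.NumberTheory.Automorphic.UnitaryGroupHermitianSphereTransitive
import Literature.NumberTheory.Automorphic.QuadraticCoordinatesIsotropicLine
import HarnessLib

/-!
# The maximal lattice of an ANISOTROPIC hermitian space over a discretely valued field: `Λ = {x | |h(x,x)| ≤ 1}` is an
# `𝒪`-lattice, `U(σ, H)`-stable, integral, and maximal (O'Meara §91A Thm. 91:1; Jacobowitz 1962 §4; Shimura 1964 §§2–3)

Topic `NumberTheory/Automorphic`; namespace `Literature.NumberTheory.Automorphic.HermitianLattice`.  THEOREMS only; no definition (the lattice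
is delivered by its membership predicate), no instance, no notation, no named fact, no `sorry`.

**Setting.** `K` a field with `Valued K ℤᵐ⁰`; `σ : K →+* K` an isometric involution (`hσ`, `hvσ`) with the (norm) property `hnorm` «every
`σ`-fixed `u` with `|u − 1| < 1` is a norm `z · σ z`» (true at every UNRAMIFIED place of a quadratic extension of local fields — ★
`UnramifiedLocalConjDatum.norm`, any residue characteristic — and at every TAMELY RAMIFIED one — ★
`UnitaryGroup.exists_traceNorm_adicCompletion_of_ramified`; it fails at the wildly ramified places, which are NOT covered here); `H ∈ M_n(K)`
`σ`-hermitian with ANISOTROPIC pairing `h(x, y) = (σx)ᵀ H y` (★ `UnitaryGroup.hermForm`): `h(x,x) = 0 ⇒ x = 0`.  Over a local field this forces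
`n ≤ 2` for hermitian forms; the case in view is the anisotropic KERNEL of a non-quasi-split hermitian space of even rank (Witt type `(r, m = 2)`).

**Results.**
* §1 `v_hermForm_mul_self_le` — CAUCHY–SCHWARZ `|h(x,y)|² ≤ |h(x,x)| · |h(y,y)|`.  Proof (O'Meara's discriminant argument for 91:1, with the
  local NORM property in place of the Local Square Theorem): if `|b|² > |p q|` (`b = h(x,y)`, `p = h(x,x)`, `q = h(y,y)`) then
  `u = 1 − pq ∕ b σb` is a `σ`-fixed principal unit, hence a norm `z σz`, and `w = b(z − 1) • x + p • y` is ISOTROPIC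
  (`p · h(w,w) = p · (bσb · zσz − (bσb − pq)) = 0`), so `w = 0`, `y ∈ Kx`, and then `|b|² = |p q|` — contradiction.
* §1 `v_hermForm_add_self_le_max` — ULTRAMETRICITY `|h(x+y, x+y)| ≤ max (|h(x,x)|, |h(y,y)|)`.
* §2 **`exists_maximalLattice`** — there is an `𝒪`-submodule `Λ` of `Kⁿ` with `x ∈ Λ ↔ |h(x,x)| ≤ 1`; `h` is integral on `Λ × Λ`; `Λ` is stable
  under `U(σ, H)`; and every `𝒪`-submodule on which `x ↦ h(x,x)` is integral is contained in `Λ` (THE maximal integral lattice — O'Meara 91:1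
  «all `𝔞`-maximal lattices on an anisotropic space are equal»).
* §3 `exists_pow_smul_mem_of_mem_stdLattice`, `exists_pow_smul_mem_stdLattice_of_v_hermForm_le` — the sandwich `ϖ^a 𝒪ⁿ ⊆ Λ ⊆ ϖ^{-b} 𝒪ⁿ`
  (`ϖ` a uniformiser; the upper bound under `CompactSpace 𝒪` by ★ COERCIVITY `exists_forall_v_sq_le_v_hermForm_self`): `Λ` is a full lattice.

This is file (i) of the «`m = 2` lattice foundation» (cell hodgecm-mathlib, crux H413 = `stmt-HodgeConjecture-24833`, 13a road A item (D)): the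
Witt lattice `𝒪^r ⊕ Λ ⊕ 𝒪^r` of a non-quasi-split hermitian space and the Iwasawa ∕ Cartan decompositions relative to its stabiliser (a special
maximal compact subgroup, [BruhatTits1972, (4.4.3)]) come next.  HONEST LABEL: HC_CM is proved only modulo the 7 printed citations (2 remaining
named inputs: hLiu418 = stmt-HodgeConjecture-24832, h413 = stmt-HodgeConjecture-24833) until rung 0 closes; unconditional local algebra.

References: O. T. O'Meara, *Introduction to Quadratic Forms* (1963), §91A Thm. 91:1 p. 242 (held text) [Omeara1963]; R. Jacobowitz, *Hermitian
forms over local fields*, Amer. J. Math. 84 (1962), §4 [Jacobowitz1962]; G. Shimura, *Arithmetic of unitary groups*, Ann. of Math. 79 (1964),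
§§2–3 (maximal lattices) [Shimura1964]; F. Bruhat, J. Tits, Publ. IHÉS 41 (1972), (4.4.3) [BruhatTits1972]; J.-P. Serre, *Local Fields* (1979),
Ch. V §2 Prop. 3 (unit norms) [Serre1979].
-/

noncomputable section

open scoped Valued WithZero Matrix MatrixGroups
open Matrix

namespace Literature.NumberTheory.Automorphic.HermitianLattice

open Literature.NumberTheory.Automorphic.UnitaryGroup

variable {K : Type*} [Field K] [Valued K ℤᵐ⁰] {σ : K →+* K} {n : Type*} [Fintype n] [DecidableEq n] {H : Matrix n n K}

/-! ## §1 Cauchy–Schwarz and ultrametricity on an anisotropic space -/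

omit [Valued K ℤᵐ⁰] in
/-- Expansion of `h(c • x + d • y, c • x + d • y)` by sesquilinearity. [cite: Jacobowitz1962, §1] -/
theorem hermForm_smul_add_smul_self (c d : K) (x y : n → K) :
    hermForm σ H (c • x + d • y) (c • x + d • y) =
      σ c * c * hermForm σ H x x + σ c * d * hermForm σ H x y + σ d * c * hermForm σ H y x + σ d * d * hermForm σ H y y := by
  rw [hermForm_add_left, hermForm_add_right, hermForm_add_right, IsQuadraticCoordinates.hermForm_smul_smul, IsQuadraticCoordinates.hermForm_smul_smul, IsQuadraticCoordinates.hermForm_smul_smul,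
    IsQuadraticCoordinates.hermForm_smul_smul]
  ring

/-- **Cauchy–Schwarz on an anisotropic hermitian space** (isometric involution with the (norm) property): `|h(x,y)|² ≤ |h(x,x)| · |h(y,y)|`.
O'Meara's discriminant argument: otherwise `1 − h(x,x)h(y,y)∕N(h(x,y))` is a `σ`-fixed principal unit, hence a norm, and the plane `Kx + Ky`
carries the explicit isotropic vector `h(x,y)(z − 1) • x + h(x,x) • y`. [cite: Omeara1963, §91A Thm. 91:1] [cite: Jacobowitz1962, §4] -/
theorem v_hermForm_mul_self_le (hσ : ∀ a, σ (σ a) = a) (hvσ : ∀ a, Valued.v (σ a) = Valued.v a)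
    (hnorm : ∀ u : K, σ u = u → Valued.v (u - 1) < 1 → ∃ z : K, z * σ z = u ∧ Valued.v (z - 1) ≤ Valued.v (u - 1))
    (hH : (H.map σ)ᵀ = H) (han : ∀ x : n → K, hermForm σ H x x = 0 → x = 0) (x y : n → K) :
    Valued.v (hermForm σ H x y) * Valued.v (hermForm σ H x y) ≤
      Valued.v (hermForm σ H x x) * Valued.v (hermForm σ H y y) := by
  by_contra hlt
  rw [not_le] at hlt
  -- the scalars `p = h(x,x)`, `q = h(y,y)`, `b = h(x,y)` (opaque)
  obtain ⟨p, hp⟩ : ∃ p : K, hermForm σ H x x = p := ⟨_, rfl⟩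
  obtain ⟨q, hq⟩ : ∃ q : K, hermForm σ H y y = q := ⟨_, rfl⟩
  obtain ⟨b, hb⟩ : ∃ b : K, hermForm σ H x y = b := ⟨_, rfl⟩
  rw [hp, hq, hb] at hlt
  have hσp : σ p = p := by rw [← hp]; exact conj_hermForm_self σ H hσ hH x
  have hσq : σ q = q := by rw [← hq]; exact conj_hermForm_self σ H hσ hH y
  have hyx : hermForm σ H y x = σ b := by rw [← hb]; exact (conj_hermForm σ H hσ hH x y).symm
  have hb0 : b ≠ 0 := fun h0 => by
    rw [h0, map_zero, mul_zero] at hlt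
    exact not_lt_of_ge zero_le hlt
  have hx0 : x ≠ 0 := fun h0 => hb0 (by rw [← hb, h0, hermForm_zero_left])
  have hp0 : p ≠ 0 := fun h0 => hx0 (han x (by rw [hp, h0]))
  have hσb0 : σ b ≠ 0 := (map_ne_zero σ).2 hb0
  have hN0 : b * σ b ≠ 0 := mul_ne_zero hb0 hσb0
  have hvN : Valued.v (b * σ b) = Valued.v b * Valued.v b := by rw [map_mul, hvσ]
  -- `u = 1 - pq / (b σb)` is a `σ`-fixed principal unit, hence a norm
  have hσu : σ (1 - p * q / (b * σ b)) = 1 - p * q / (b * σ b) := by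
    rw [map_sub, map_one, map_div₀, map_mul, map_mul, hσp, hσq, hσ, mul_comm (σ b) b]
  have hu1 : Valued.v ((1 - p * q / (b * σ b)) - 1) < 1 := by
    rw [show (1 - p * q / (b * σ b)) - 1 = -(p * q / (b * σ b)) by ring, Valuation.map_neg, map_div₀, map_mul, hvN,
      div_lt_one₀ (lt_of_le_of_lt zero_le hlt)]
    exact hlt
  obtain ⟨z, hz, -⟩ := hnorm _ hσu hu1
  have hzN : z * σ z * (b * σ b) = b * σ b - p * q := by
    rw [hz, sub_mul, one_mul, div_mul_cancel₀ _ hN0]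
  -- the isotropic vector `w = (b (z - 1)) • x + p • y`
  have hw : hermForm σ H ((b * (z - 1)) • x + p • y) ((b * (z - 1)) • x + p • y) = 0 := by
    rw [hermForm_smul_add_smul_self, hp, hq, hb, hyx, map_mul, map_sub, map_one, hσp]
    linear_combination p * hzN
  have hw0 := han _ hw
  -- hence `y = μ • x` with `μ = -(b (z - 1)) / p`
  have hy : y = (-(b * (z - 1)) / p) • x := by
    have h1 : p • y = -((b * (z - 1)) • x) := eq_neg_of_add_eq_zero_right hw0
    calc y = p⁻¹ • (p • y) := by rw [smul_smul, inv_mul_cancel₀ hp0, one_smul]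
      _ = (-(b * (z - 1)) / p) • x := by rw [h1, ← neg_smul, smul_smul, div_eq_inv_mul]
  -- and then `|b|² = |p| |q|`, contradicting the strict inequality
  obtain ⟨μ, hμ⟩ : ∃ μ : K, -(b * (z - 1)) / p = μ := ⟨_, rfl⟩
  rw [hμ] at hy
  have hb' : b = μ * p := by rw [← hb, hy, hermForm_smul_right, hp]
  have hq' : q = σ μ * μ * p := by rw [← hq, hy, IsQuadraticCoordinates.hermForm_smul_smul, hp]
  rw [hb', hq', map_mul, map_mul, map_mul, hvσ] at hlt
  exact lt_irrefl _ (by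
    calc Valued.v μ * Valued.v p * (Valued.v μ * Valued.v p)
        = Valued.v p * (Valued.v μ * Valued.v μ * Valued.v p) := by ac_rfl
      _ < Valued.v μ * Valued.v p * (Valued.v μ * Valued.v p) := hlt)

/-- **Ultrametricity of `x ↦ |h(x,x)|` on an anisotropic hermitian space**: `|h(x+y, x+y)| ≤ max (|h(x,x)|, |h(y,y)|)` — the set
`{x | |h(x,x)| ≤ |𝔞|}` is closed under addition. [cite: Omeara1963, §91A Thm. 91:1] [cite: Shimura1964, §2] -/
theorem v_hermForm_add_self_le_max (hσ : ∀ a, σ (σ a) = a) (hvσ : ∀ a, Valued.v (σ a) = Valued.v a)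
    (hnorm : ∀ u : K, σ u = u → Valued.v (u - 1) < 1 → ∃ z : K, z * σ z = u ∧ Valued.v (z - 1) ≤ Valued.v (u - 1))
    (hH : (H.map σ)ᵀ = H) (han : ∀ x : n → K, hermForm σ H x x = 0 → x = 0) (x y : n → K) :
    Valued.v (hermForm σ H (x + y) (x + y)) ≤ max (Valued.v (hermForm σ H x x)) (Valued.v (hermForm σ H y y)) := by
  have hcs := v_hermForm_mul_self_le hσ hvσ hnorm hH han x y
  -- `|h(x,y)| ≤ max |h(x,x)| |h(y,y)|`
  have hbM : Valued.v (hermForm σ H x y) ≤ max (Valued.v (hermForm σ H x x)) (Valued.v (hermForm σ H y y)) := by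
    by_contra hgt
    rw [not_le] at hgt
    have h1 : Valued.v (hermForm σ H x x) * Valued.v (hermForm σ H y y) ≤
        max (Valued.v (hermForm σ H x x)) (Valued.v (hermForm σ H y y)) *
          max (Valued.v (hermForm σ H x x)) (Valued.v (hermForm σ H y y)) :=
      mul_le_mul' (le_max_left _ _) (le_max_right _ _)
    have h2 : max (Valued.v (hermForm σ H x x)) (Valued.v (hermForm σ H y y)) *
          max (Valued.v (hermForm σ H x x)) (Valued.v (hermForm σ H y y)) <
        Valued.v (hermForm σ H x y) * Valued.v (hermForm σ H x y) :=
      mul_lt_mul'' hgt hgt zero_le zero_le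
    exact not_lt_of_ge hcs (lt_of_le_of_lt h1 h2)
  have hyx : Valued.v (hermForm σ H y x) = Valued.v (hermForm σ H x y) := by
    rw [← conj_hermForm σ H hσ hH x y, hvσ]
  have hexp : hermForm σ H (x + y) (x + y) =
      hermForm σ H x x + hermForm σ H x y + (hermForm σ H y x + hermForm σ H y y) := by
    rw [hermForm_add_left, hermForm_add_right, hermForm_add_right, add_assoc]
  rw [hexp]
  refine (Valuation.map_add _ _ _).trans (max_le ((Valuation.map_add _ _ _).trans (max_le (le_max_left _ _) hbM))
    ((Valuation.map_add _ _ _).trans (max_le (hyx ▸ hbM) (le_max_right _ _))))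

/-! ## §2 The maximal lattice `Λ = {x | |h(x,x)| ≤ 1}` -/

/-- **THE MAXIMAL LATTICE OF AN ANISOTROPIC HERMITIAN SPACE** (isometric involution with the (norm) property): there is an `𝒪`-submodule `Λ`
of `Kⁿ` with (1) `x ∈ Λ ↔ |h(x,x)| ≤ 1`; (2) `h` is `𝒪`-valued on `Λ × Λ` (Cauchy–Schwarz); (3) `Λ` is stable under the unitary group `U(σ, H)`;
(4) every `𝒪`-submodule on which `x ↦ h(x,x)` is integral lies in `Λ` — `Λ` is THE unique maximal integral lattice (O'Meara 91:1 «all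
`𝔞`-maximal lattices on an anisotropic space are equal»; its stabiliser is the good maximal compact subgroup of [BruhatTits1972, (4.4.3)] for the
anisotropic kernel).  No definition is introduced: `Λ` is characterised by (1). [cite: Omeara1963, §91A Thm. 91:1] [cite: Jacobowitz1962, §4]
[cite: Shimura1964, §§2–3] -/
theorem exists_maximalLattice (hσ : ∀ a, σ (σ a) = a) (hvσ : ∀ a, Valued.v (σ a) = Valued.v a)
    (hnorm : ∀ u : K, σ u = u → Valued.v (u - 1) < 1 → ∃ z : K, z * σ z = u ∧ Valued.v (z - 1) ≤ Valued.v (u - 1))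
    (hH : (H.map σ)ᵀ = H) (han : ∀ x : n → K, hermForm σ H x x = 0 → x = 0) :
    ∃ Λ : Submodule 𝒪[K] (n → K),
      (∀ x, x ∈ Λ ↔ Valued.v (hermForm σ H x x) ≤ 1) ∧
      (∀ x ∈ Λ, ∀ y ∈ Λ, Valued.v (hermForm σ H x y) ≤ 1) ∧
      (∀ g ∈ unitaryGroupOfForm σ H, ∀ x ∈ Λ, (g : Matrix n n K) *ᵥ x ∈ Λ) ∧
      (∀ M : Submodule 𝒪[K] (n → K), (∀ x ∈ M, Valued.v (hermForm σ H x x) ≤ 1) → M ≤ Λ) := by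
  let Λ : Submodule 𝒪[K] (n → K) :=
    { carrier := {x | Valued.v (hermForm σ H x x) ≤ 1}
      zero_mem' := by
        change Valued.v (hermForm σ H 0 0) ≤ 1
        rw [hermForm_zero_left, map_zero]; exact zero_le
      add_mem' := fun {x y} hx hy => (v_hermForm_add_self_le_max hσ hvσ hnorm hH han x y).trans (max_le hx hy)
      smul_mem' := fun c {x} hx => by
        change Valued.v (hermForm σ H ((c : K) • x) ((c : K) • x)) ≤ 1
        rw [IsQuadraticCoordinates.hermForm_smul_smul, map_mul, map_mul, hvσ]
        have hc : Valued.v (c : K) ≤ 1 := c.2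
        calc Valued.v (c : K) * Valued.v (c : K) * Valued.v (hermForm σ H x x) ≤ 1 * 1 * 1 :=
              mul_le_mul' (mul_le_mul' hc hc) hx
          _ = 1 := by rw [mul_one, mul_one] }
  have hmem : ∀ x, x ∈ Λ ↔ Valued.v (hermForm σ H x x) ≤ 1 := fun _ => Iff.rfl
  refine ⟨Λ, hmem, fun x hx y hy => ?_, fun g hg x hx => ?_, fun M hM x hx => (hmem x).2 (hM x hx)⟩
  · -- integrality from Cauchy–Schwarz
    rw [hmem] at hx hy
    by_contra hgt
    rw [not_le] at hgt
    have h1 := v_hermForm_mul_self_le hσ hvσ hnorm hH han x y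
    have h2 : Valued.v (hermForm σ H x x) * Valued.v (hermForm σ H y y) ≤ 1 * 1 := mul_le_mul' hx hy
    rw [mul_one] at h2
    exact not_lt_of_ge (h1.trans h2) (one_lt_mul'' hgt hgt)
  · -- stability under `U(σ, H)`
    rw [hmem] at hx ⊢
    rwa [(mem_unitaryGroupOfForm_iff_hermForm σ H g).1 hg]

/-! ## §3 `Λ` is a full lattice: `ϖ^a 𝒪ⁿ ⊆ Λ ⊆ ϖ^{-b} 𝒪ⁿ` -/

/-- **`h` is bounded on `𝒪ⁿ`**: `|h(x,x)| ≤ exp C` for all `x` with integral coordinates (`C` bounds the entries of `H`). [cite: Shimura1964, §2] -/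
theorem exists_forall_v_hermForm_self_le_of_mem_stdLattice (hvσ : ∀ a, Valued.v (σ a) = Valued.v a) (H : Matrix n n K) :
    ∃ C : ℤ, ∀ x : n → K, (∀ i, Valued.v (x i) ≤ 1) → Valued.v (hermForm σ H x x) ≤ WithZero.exp C := by
  classical
  -- a common bound for the entries of `H`
  have hbd : ∃ C : ℤ, ∀ i j, Valued.v (H i j) ≤ WithZero.exp C := by
    have hfin : ∀ i j, ∃ C : ℤ, Valued.v (H i j) ≤ WithZero.exp C := fun i j => by
      by_cases h0 : Valued.v (H i j) = 0
      · exact ⟨0, by rw [h0]; exact zero_le⟩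
      · exact ⟨WithZero.log (Valued.v (H i j)), by rw [WithZero.exp_log h0]⟩
    choose C hC using hfin
    refine ⟨((Finset.univ.sup fun ij : n × n => (C ij.1 ij.2).toNat : ℕ) : ℤ), fun i j => (hC i j).trans (WithZero.exp_le_exp.2 ?_)⟩
    have h1 : (C i j).toNat ≤ Finset.univ.sup fun ij : n × n => (C ij.1 ij.2).toNat :=
      Finset.le_sup (f := fun ij : n × n => (C ij.1 ij.2).toNat) (Finset.mem_univ (i, j))
    omega
  by_cases hn : Nonempty n
  · obtain ⟨C, hC⟩ := hbd
    refine ⟨C, fun x hx => ?_⟩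
    rw [hermForm_apply, dotProduct]
    refine (Valuation.map_sum_le _ fun i _ => ?_)
    rw [Function.comp_apply, map_mul, hvσ, Matrix.mulVec, dotProduct]
    have h2 : Valued.v (∑ j, H i j * x j) ≤ WithZero.exp C := Valuation.map_sum_le _ fun j _ => by
      rw [map_mul]
      calc Valued.v (H i j) * Valued.v (x j) ≤ WithZero.exp C * 1 := mul_le_mul' (hC i j) (hx j)
        _ = WithZero.exp C := mul_one _
    calc Valued.v (x i) * Valued.v (∑ j, H i j * x j) ≤ 1 * WithZero.exp C := mul_le_mul' (hx i) h2
      _ = WithZero.exp C := one_mul _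
  · refine ⟨0, fun x _ => ?_⟩
    have hx0 : x = 0 := funext fun i => absurd ⟨i⟩ hn
    rw [hx0, hermForm_zero_left, map_zero]
    exact zero_le

/-- **Lower bound `ϖ^a 𝒪ⁿ ⊆ Λ`**: for a uniformiser `ϖ` there is `a : ℕ` with `|h(ϖ^a x, ϖ^a x)| ≤ 1` for every `x ∈ 𝒪ⁿ`. [cite: Shimura1964, §2] -/
theorem exists_pow_smul_mem_of_mem_stdLattice {ϖ : K} (hϖ : Valued.v ϖ = WithZero.exp (-1 : ℤ))
    (hvσ : ∀ a, Valued.v (σ a) = Valued.v a) (H : Matrix n n K) :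
    ∃ a : ℕ, ∀ x : n → K, (∀ i, Valued.v (x i) ≤ 1) → Valued.v (hermForm σ H ((ϖ ^ a) • x) ((ϖ ^ a) • x)) ≤ 1 := by
  obtain ⟨C, hC⟩ := exists_forall_v_hermForm_self_le_of_mem_stdLattice (σ := σ) hvσ H
  refine ⟨C.toNat, fun x hx => ?_⟩
  rw [IsQuadraticCoordinates.hermForm_smul_smul, map_mul, map_mul, hvσ, map_pow, hϖ, ← WithZero.exp_nsmul, nsmul_eq_mul, mul_neg, mul_one]
  calc WithZero.exp (-(C.toNat : ℤ)) * WithZero.exp (-(C.toNat : ℤ)) * Valued.v (hermForm σ H x x)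
      ≤ WithZero.exp (-(C.toNat : ℤ)) * 1 * WithZero.exp C :=
        mul_le_mul' (mul_le_mul' le_rfl (by rw [← WithZero.exp_zero, WithZero.exp_le_exp]; omega)) (hC x hx)
    _ = WithZero.exp (-(C.toNat : ℤ) + C) := by rw [mul_one, WithZero.exp_add]
    _ ≤ 1 := by rw [← WithZero.exp_zero, WithZero.exp_le_exp]; omega

/-- **Upper bound `Λ ⊆ ϖ^{-b} 𝒪ⁿ`** (compact valuation ring): there is `b : ℕ` such that `|h(x,x)| ≤ 1` forces `|ϖ^b x_i| ≤ 1` for all `i` — ★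
COERCIVITY `exists_forall_v_sq_le_v_hermForm_self` of the anisotropic form.  With §2 and the lower bound, `Λ` is a full `𝒪`-lattice in `Kⁿ`
(finitely generated of rank `n`, commensurable with `𝒪ⁿ`). [cite: Shimura1964, §2] [cite: Omeara1963, §91A] -/
theorem exists_pow_smul_mem_stdLattice_of_v_hermForm_le [CompactSpace 𝒪[K]] {ϖ : K} (hϖ : Valued.v ϖ = WithZero.exp (-1 : ℤ))
    (hvσ : ∀ a, Valued.v (σ a) = Valued.v a) (han : ∀ x : n → K, hermForm σ H x x = 0 → x = 0) :
    ∃ b : ℕ, ∀ x : n → K, Valued.v (hermForm σ H x x) ≤ 1 → ∀ i, Valued.v ((ϖ ^ b) • x i) ≤ 1 := by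
  obtain ⟨m, hm⟩ := exists_forall_v_sq_le_v_hermForm_self (σ := σ) (H := H) hϖ hvσ han
  refine ⟨m, fun x hx i => ?_⟩
  have h1 : Valued.v (x i) * Valued.v (x i) * WithZero.exp (-(m : ℤ)) ≤ 1 := (hm x i).trans hx
  -- `|x i| ≤ exp m`: otherwise `|x i|² exp(-m) > exp(2m) exp(-m) = exp m ≥ 1`
  have h2 : Valued.v (x i) ≤ WithZero.exp (m : ℤ) := by
    by_contra hgt
    rw [not_le] at hgt
    have h3 : WithZero.exp (m : ℤ) * WithZero.exp (m : ℤ) * WithZero.exp (-(m : ℤ)) <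
        Valued.v (x i) * Valued.v (x i) * WithZero.exp (-(m : ℤ)) :=
      mul_lt_mul_of_pos_right (mul_lt_mul'' hgt hgt zero_le zero_le) (WithZero.exp_pos)
    rw [← WithZero.exp_add, ← WithZero.exp_add] at h3
    have h4 : (1 : ℤᵐ⁰) ≤ WithZero.exp ((m : ℤ) + m + -(m : ℤ)) := by
      rw [← WithZero.exp_zero, WithZero.exp_le_exp]; omega
    exact not_lt_of_ge h1 (lt_of_le_of_lt h4 h3)
  rw [smul_eq_mul, map_mul, map_pow, hϖ, ← WithZero.exp_nsmul, nsmul_eq_mul, mul_neg, mul_one]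
  calc WithZero.exp (-(m : ℤ)) * Valued.v (x i) ≤ WithZero.exp (-(m : ℤ)) * WithZero.exp (m : ℤ) := mul_le_mul' le_rfl h2
    _ = 1 := by rw [← WithZero.exp_add, neg_add_cancel, WithZero.exp_zero]

end Literature.NumberTheory.Automorphic.HermitianLattice

end
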